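import Mathlib
import Literature.GroupTheory.DiffuseGroups.Bowditch2000

/-!
# The Stix–Vdovina (4,4)-lattice `Γ_SV` is not diffuse

`Γ_SV = ⟨a, b, x, y ∣ axay, ax⁻¹bx⁻¹, ay⁻¹b⁻¹y⁻¹, bxby⁻¹⟩` is one of the two irreducible torsion-free
BMW groups of degree `(4,4)` (a cocompact lattice in `PGL₂(F₃((t))) × PGL₂(F₃((t)))`). We certify that the
whole ball of radius 2 of its Cayley graph (49 elements) is a ravel, so `Γ_SV` is not diffuse in Bowditch's sense
and therefore not left-orderable.

References: [cite: Caprace2017, Example 4.3] for the presentation (the group is due to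
Stix–Vdovina [cite: StixVdovina2013]); [cite: Bowditch2000, §1–2] and [cite: KionkeRaimbault2016, §2.1] for diffuse groups,
extremal points and ravels (`Literature.GroupTheory.DiffuseGroups.Bowditch2000`).

The certificate (the 49 words, the witness maps `J`, `K` and the separating finite quotient) was found
by machine search (extremal-point peeling of the ball of radius 2 removes nothing, i.e. the whole ball is a ravel; the witnesses were then chosen so that one quotient of order 2 separates every pair; AI-run computation of the
`pub-kaplansky` unit, 2026-08-19, cross-checked by two independent implementations of the word problem) and is checked here by the kernel: the word identities by
rewriting to the `VH` normal form with the sixteen corner relations of the square complex, the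
inequalities through an explicit homomorphism to `Equiv.Perm (Fin 2)`.
-/

namespace Literature.GroupTheory.BMWGroups.Caprace2017

open Literature.GroupTheory.DiffuseGroups

namespace GammaSV

/-- Generator symbols: `a`, `b` (vertical) and `x`, `y` (horizontal). [cite: Caprace2017, Example 4.3] -/
inductive L | a | b | x | y
  deriving DecidableEq, Repr

/-- The four relators (squares of the BMW complex). [cite: Caprace2017, Example 4.3] -/
def r (k : Fin 4) : FreeGroup L :=
  ![FreeGroup.of L.a * FreeGroup.of L.x * FreeGroup.of L.a * FreeGroup.of L.y,
    FreeGroup.of L.a * (FreeGroup.of L.x)⁻¹ * FreeGroup.of L.b * (FreeGroup.of L.x)⁻¹,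
    FreeGroup.of L.a * (FreeGroup.of L.y)⁻¹ * (FreeGroup.of L.b)⁻¹ * (FreeGroup.of L.y)⁻¹,
    FreeGroup.of L.b * FreeGroup.of L.x * FreeGroup.of L.b * (FreeGroup.of L.y)⁻¹] k

/-- The relator set. [cite: Caprace2017, Example 4.3] -/
def rels : Set (FreeGroup L) := Set.range r

end GammaSV

/-- The Stix–Vdovina lattice `Γ_SV = ⟨a, b, x, y ∣ axay, ax⁻¹bx⁻¹, ay⁻¹b⁻¹y⁻¹, bxby⁻¹⟩`, an irreducible torsion-free BMW group of degree (4,4). [cite: Caprace2017, Example 4.3] -/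
abbrev GammaSVGroup : Type := PresentedGroup GammaSV.rels

namespace GammaSV

/-- The generator `a` (vertical). [cite: Caprace2017, Example 4.3] -/
def a : GammaSVGroup := PresentedGroup.of L.a
/-- The generator `b` (vertical). [cite: Caprace2017, Example 4.3] -/
def b : GammaSVGroup := PresentedGroup.of L.b
/-- The generator `x` (horizontal). [cite: Caprace2017, Example 4.3] -/
def x : GammaSVGroup := PresentedGroup.of L.x
/-- The generator `y` (horizontal). [cite: Caprace2017, Example 4.3] -/
def y : GammaSVGroup := PresentedGroup.of L.y

/-- The relators hold in the presented group. [cite: Caprace2017, Example 4.3] -/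
theorem r_eq_one (k : Fin 4) : (PresentedGroup.mk rels (r k) : GammaSVGroup) = 1 :=
  (QuotientGroup.eq_one_iff _).2 (Subgroup.subset_normalClosure ⟨k, rfl⟩)

/-- Relator 1: `a * x * a * y = 1`. [cite: Caprace2017, Example 4.3] -/
theorem rel1 : a * x * a * y = 1 := by
  have h := r_eq_one 0
  simpa [r, a, b, x, y, PresentedGroup.of, mul_assoc] using h

/-- Relator 2: `a * x⁻¹ * b * x⁻¹ = 1`. [cite: Caprace2017, Example 4.3] -/
theorem rel2 : a * x⁻¹ * b * x⁻¹ = 1 := by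
  have h := r_eq_one 1
  simpa [r, a, b, x, y, PresentedGroup.of, mul_assoc] using h

/-- Relator 3: `a * y⁻¹ * b⁻¹ * y⁻¹ = 1`. [cite: Caprace2017, Example 4.3] -/
theorem rel3 : a * y⁻¹ * b⁻¹ * y⁻¹ = 1 := by
  have h := r_eq_one 2
  simpa [r, a, b, x, y, PresentedGroup.of, mul_assoc] using h

/-- Relator 4: `b * x * b * y⁻¹ = 1`. [cite: Caprace2017, Example 4.3] -/
theorem rel4 : b * x * b * y⁻¹ = 1 := by
  have h := r_eq_one 3
  simpa [r, a, b, x, y, PresentedGroup.of, mul_assoc] using h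

/-! ## The sixteen corner relations `h v = v' h'` (one per corner of the link `K_{4,4}`) -/

/-- Corner relation `y⁻¹ * b⁻¹ = a⁻¹ * y` (from relator 3). [cite: Caprace2017, Example 4.3] -/
theorem c_yi_bi : y⁻¹ * b⁻¹ = a⁻¹ * y := by
  calc y⁻¹ * b⁻¹ = (a⁻¹ * (a * y⁻¹ * b⁻¹ * y⁻¹) * a) * (a⁻¹ * y) := by group
    _ = a⁻¹ * y := by rw [rel3]; group

/-- Corner relation `c_yi_bi` in associated form (for rewriting inside longer words). [cite: Caprace2017, Example 4.3] -/
theorem c_yi_bi' (w : GammaSVGroup) : y⁻¹ * (b⁻¹ * w) = a⁻¹ * (y * w) := by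
  rw [← mul_assoc, c_yi_bi, mul_assoc]

/-- Corner relation `y⁻¹ * a⁻¹ = a * x` (from relator 1). [cite: Caprace2017, Example 4.3] -/
theorem c_yi_ai : y⁻¹ * a⁻¹ = a * x := by
  calc y⁻¹ * a⁻¹ = ((a * x * a * y)⁻¹) * (a * x) := by group
    _ = a * x := by rw [rel1]; group

/-- Corner relation `c_yi_ai` in associated form (for rewriting inside longer words). [cite: Caprace2017, Example 4.3] -/
theorem c_yi_ai' (w : GammaSVGroup) : y⁻¹ * (a⁻¹ * w) = a * (x * w) := by
  rw [← mul_assoc, c_yi_ai, mul_assoc]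

/-- Corner relation `y⁻¹ * a = b * y` (from relator 3). [cite: Caprace2017, Example 4.3] -/
theorem c_yi_a : y⁻¹ * a = b * y := by
  calc y⁻¹ * a = (b * y * a⁻¹ * (a * y⁻¹ * b⁻¹ * y⁻¹) * a * y⁻¹ * b⁻¹) * (b * y) := by group
    _ = b * y := by rw [rel3]; group

/-- Corner relation `c_yi_a` in associated form (for rewriting inside longer words). [cite: Caprace2017, Example 4.3] -/
theorem c_yi_a' (w : GammaSVGroup) : y⁻¹ * (a * w) = b * (y * w) := by
  rw [← mul_assoc, c_yi_a, mul_assoc]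

/-- Corner relation `y⁻¹ * b = b⁻¹ * x⁻¹` (from relator 4). [cite: Caprace2017, Example 4.3] -/
theorem c_yi_b : y⁻¹ * b = b⁻¹ * x⁻¹ := by
  calc y⁻¹ * b = (b⁻¹ * x⁻¹ * b⁻¹ * (b * x * b * y⁻¹) * b * x * b) * (b⁻¹ * x⁻¹) := by group
    _ = b⁻¹ * x⁻¹ := by rw [rel4]; group

/-- Corner relation `c_yi_b` in associated form (for rewriting inside longer words). [cite: Caprace2017, Example 4.3] -/
theorem c_yi_b' (w : GammaSVGroup) : y⁻¹ * (b * w) = b⁻¹ * (x⁻¹ * w) := by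
  rw [← mul_assoc, c_yi_b, mul_assoc]

/-- Corner relation `x⁻¹ * b⁻¹ = b * y⁻¹` (from relator 4). [cite: Caprace2017, Example 4.3] -/
theorem c_xi_bi : x⁻¹ * b⁻¹ = b * y⁻¹ := by
  calc x⁻¹ * b⁻¹ = (b * y⁻¹ * (b * x * b * y⁻¹)⁻¹ * y * b⁻¹) * (b * y⁻¹) := by group
    _ = b * y⁻¹ := by rw [rel4]; group

/-- Corner relation `c_xi_bi` in associated form (for rewriting inside longer words). [cite: Caprace2017, Example 4.3] -/
theorem c_xi_bi' (w : GammaSVGroup) : x⁻¹ * (b⁻¹ * w) = b * (y⁻¹ * w) := by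
  rw [← mul_assoc, c_xi_bi, mul_assoc]

/-- Corner relation `x⁻¹ * a⁻¹ = a * y` (from relator 1). [cite: Caprace2017, Example 4.3] -/
theorem c_xi_ai : x⁻¹ * a⁻¹ = a * y := by
  calc x⁻¹ * a⁻¹ = (a * y * (a * x * a * y)⁻¹ * y⁻¹ * a⁻¹) * (a * y) := by group
    _ = a * y := by rw [rel1]; group

/-- Corner relation `c_xi_ai` in associated form (for rewriting inside longer words). [cite: Caprace2017, Example 4.3] -/
theorem c_xi_ai' (w : GammaSVGroup) : x⁻¹ * (a⁻¹ * w) = a * (y * w) := by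
  rw [← mul_assoc, c_xi_ai, mul_assoc]

/-- Corner relation `x⁻¹ * a = b⁻¹ * x` (from relator 2). [cite: Caprace2017, Example 4.3] -/
theorem c_xi_a : x⁻¹ * a = b⁻¹ * x := by
  calc x⁻¹ * a = (b⁻¹ * x * a⁻¹ * (a * x⁻¹ * b * x⁻¹) * a * x⁻¹ * b) * (b⁻¹ * x) := by group
    _ = b⁻¹ * x := by rw [rel2]; group

/-- Corner relation `c_xi_a` in associated form (for rewriting inside longer words). [cite: Caprace2017, Example 4.3] -/
theorem c_xi_a' (w : GammaSVGroup) : x⁻¹ * (a * w) = b⁻¹ * (x * w) := by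
  rw [← mul_assoc, c_xi_a, mul_assoc]

/-- Corner relation `x⁻¹ * b = a⁻¹ * x` (from relator 2). [cite: Caprace2017, Example 4.3] -/
theorem c_xi_b : x⁻¹ * b = a⁻¹ * x := by
  calc x⁻¹ * b = (a⁻¹ * (a * x⁻¹ * b * x⁻¹) * a) * (a⁻¹ * x) := by group
    _ = a⁻¹ * x := by rw [rel2]; group

/-- Corner relation `c_xi_b` in associated form (for rewriting inside longer words). [cite: Caprace2017, Example 4.3] -/
theorem c_xi_b' (w : GammaSVGroup) : x⁻¹ * (b * w) = a⁻¹ * (x * w) := by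
  rw [← mul_assoc, c_xi_b, mul_assoc]

/-- Corner relation `x * b⁻¹ = a * x⁻¹` (from relator 2). [cite: Caprace2017, Example 4.3] -/
theorem c_x_bi : x * b⁻¹ = a * x⁻¹ := by
  calc x * b⁻¹ = ((a * x⁻¹ * b * x⁻¹)⁻¹) * (a * x⁻¹) := by group
    _ = a * x⁻¹ := by rw [rel2]; group

/-- Corner relation `c_x_bi` in associated form (for rewriting inside longer words). [cite: Caprace2017, Example 4.3] -/
theorem c_x_bi' (w : GammaSVGroup) : x * (b⁻¹ * w) = a * (x⁻¹ * w) := by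
  rw [← mul_assoc, c_x_bi, mul_assoc]

/-- Corner relation `x * a⁻¹ = b * x⁻¹` (from relator 2). [cite: Caprace2017, Example 4.3] -/
theorem c_x_ai : x * a⁻¹ = b * x⁻¹ := by
  calc x * a⁻¹ = (b * x⁻¹ * (a * x⁻¹ * b * x⁻¹)⁻¹ * x * b⁻¹) * (b * x⁻¹) := by group
    _ = b * x⁻¹ := by rw [rel2]; group

/-- Corner relation `c_x_ai` in associated form (for rewriting inside longer words). [cite: Caprace2017, Example 4.3] -/
theorem c_x_ai' (w : GammaSVGroup) : x * (a⁻¹ * w) = b * (x⁻¹ * w) := by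
  rw [← mul_assoc, c_x_ai, mul_assoc]

/-- Corner relation `x * a = a⁻¹ * y⁻¹` (from relator 1). [cite: Caprace2017, Example 4.3] -/
theorem c_x_a : x * a = a⁻¹ * y⁻¹ := by
  calc x * a = (a⁻¹ * (a * x * a * y) * a) * (a⁻¹ * y⁻¹) := by group
    _ = a⁻¹ * y⁻¹ := by rw [rel1]; group

/-- Corner relation `c_x_a` in associated form (for rewriting inside longer words). [cite: Caprace2017, Example 4.3] -/
theorem c_x_a' (w : GammaSVGroup) : x * (a * w) = a⁻¹ * (y⁻¹ * w) := by
  rw [← mul_assoc, c_x_a, mul_assoc]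

/-- Corner relation `x * b = b⁻¹ * y` (from relator 4). [cite: Caprace2017, Example 4.3] -/
theorem c_x_b : x * b = b⁻¹ * y := by
  calc x * b = (b⁻¹ * (b * x * b * y⁻¹) * b) * (b⁻¹ * y) := by group
    _ = b⁻¹ * y := by rw [rel4]; group

/-- Corner relation `c_x_b` in associated form (for rewriting inside longer words). [cite: Caprace2017, Example 4.3] -/
theorem c_x_b' (w : GammaSVGroup) : x * (b * w) = b⁻¹ * (y * w) := by
  rw [← mul_assoc, c_x_b, mul_assoc]

/-- Corner relation `y * b⁻¹ = b * x` (from relator 4). [cite: Caprace2017, Example 4.3] -/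
theorem c_y_bi : y * b⁻¹ = b * x := by
  calc y * b⁻¹ = ((b * x * b * y⁻¹)⁻¹) * (b * x) := by group
    _ = b * x := by rw [rel4]; group

/-- Corner relation `c_y_bi` in associated form (for rewriting inside longer words). [cite: Caprace2017, Example 4.3] -/
theorem c_y_bi' (w : GammaSVGroup) : y * (b⁻¹ * w) = b * (x * w) := by
  rw [← mul_assoc, c_y_bi, mul_assoc]

/-- Corner relation `y * a⁻¹ = b⁻¹ * y⁻¹` (from relator 3). [cite: Caprace2017, Example 4.3] -/
theorem c_y_ai : y * a⁻¹ = b⁻¹ * y⁻¹ := by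
  calc y * a⁻¹ = (b⁻¹ * y⁻¹ * (a * y⁻¹ * b⁻¹ * y⁻¹)⁻¹ * y * b) * (b⁻¹ * y⁻¹) := by group
    _ = b⁻¹ * y⁻¹ := by rw [rel3]; group

/-- Corner relation `c_y_ai` in associated form (for rewriting inside longer words). [cite: Caprace2017, Example 4.3] -/
theorem c_y_ai' (w : GammaSVGroup) : y * (a⁻¹ * w) = b⁻¹ * (y⁻¹ * w) := by
  rw [← mul_assoc, c_y_ai, mul_assoc]

/-- Corner relation `y * a = a⁻¹ * x⁻¹` (from relator 1). [cite: Caprace2017, Example 4.3] -/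
theorem c_y_a : y * a = a⁻¹ * x⁻¹ := by
  calc y * a = (a⁻¹ * x⁻¹ * a⁻¹ * (a * x * a * y) * a * x * a) * (a⁻¹ * x⁻¹) := by group
    _ = a⁻¹ * x⁻¹ := by rw [rel1]; group

/-- Corner relation `c_y_a` in associated form (for rewriting inside longer words). [cite: Caprace2017, Example 4.3] -/
theorem c_y_a' (w : GammaSVGroup) : y * (a * w) = a⁻¹ * (x⁻¹ * w) := by
  rw [← mul_assoc, c_y_a, mul_assoc]

/-- Corner relation `y * b = a * y⁻¹` (from relator 3). [cite: Caprace2017, Example 4.3] -/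
theorem c_y_b : y * b = a * y⁻¹ := by
  calc y * b = ((a * y⁻¹ * b⁻¹ * y⁻¹)⁻¹) * (a * y⁻¹) := by group
    _ = a * y⁻¹ := by rw [rel3]; group

/-- Corner relation `c_y_b` in associated form (for rewriting inside longer words). [cite: Caprace2017, Example 4.3] -/
theorem c_y_b' (w : GammaSVGroup) : y * (b * w) = a * (y⁻¹ * w) := by
  rw [← mul_assoc, c_y_b, mul_assoc]

/-! ## The ravel: 49 elements of the ball of radius 2 (by word length: {'0': 1, '1': 8, '2': 40}) -/

/-- The 49 elements of the ravel, as words in the generators. [cite: KionkeRaimbault2016, §2.1] -/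
def f : Fin 49 → GammaSVGroup :=
  ![1,
    y⁻¹,
    x⁻¹,
    x,
    y,
    b⁻¹,
    a⁻¹,
    a,
    b,
    y⁻¹ * y⁻¹,
    y⁻¹ * x⁻¹,
    y⁻¹ * x,
    x⁻¹ * y⁻¹,
    x⁻¹ * x⁻¹,
    x⁻¹ * y,
    x * y⁻¹,
    x * x,
    x * y,
    y * x⁻¹,
    y * x,
    y * y,
    b⁻¹ * y⁻¹,
    b⁻¹ * x⁻¹,
    b⁻¹ * x,
    b⁻¹ * y,
    b⁻¹ * b⁻¹,
    b⁻¹ * a⁻¹,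
    b⁻¹ * a,
    a⁻¹ * y⁻¹,
    a⁻¹ * x⁻¹,
    a⁻¹ * x,
    a⁻¹ * y,
    a⁻¹ * b⁻¹,
    a⁻¹ * a⁻¹,
    a⁻¹ * b,
    a * y⁻¹,
    a * x⁻¹,
    a * x,
    a * y,
    a * b⁻¹,
    a * a,
    a * b,
    b * y⁻¹,
    b * x⁻¹,
    b * x,
    b * y,
    b * a⁻¹,
    b * a,
    b * b]

/-- First witness map: `f (J i) · (f i)⁻¹ · f (K i) = f i`. [cite: KionkeRaimbault2016, §2.1] -/
def J : Fin 49 → Fin 49 := ![1, 0, 0, 0, 0, 1, 3, 1, 2, 22, 29, 22, 21, 22, 23, 24, 24, 28, 21, 23, 24, 0, 0, 0, 0, 21, 23, 21, 0, 0, 0, 0, 28, 21, 24, 0, 0, 0, 0, 31, 23, 22, 0, 0, 0, 0, 21, 23, 30]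

/-- Second witness map. [cite: KionkeRaimbault2016, §2.1] -/
def K : Fin 49 → Fin 49 := ![4, 9, 13, 16, 20, 3, 4, 2, 4, 37, 43, 45, 28, 29, 42, 43, 28, 36, 44, 37, 38, 26, 10, 27, 17, 23, 24, 22, 15, 18, 34, 32, 30, 43, 35, 41, 39, 11, 14, 42, 45, 30, 12, 46, 19, 47, 38, 29, 35]

/-- The witness identities `f (J i) · (f i)⁻¹ · f (K i) = f i`, by rewriting both sides to `VH` normal form
with the corner relations. [cite: KionkeRaimbault2016, §2.1] -/
theorem f_rel : ∀ i : Fin 49, f (J i) * (f i)⁻¹ * f (K i) = f i := by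
  intro i
  fin_cases i
  all_goals
    simp only [f, J, K, Fin.isValue, Matrix.cons_val_zero,
      Matrix.cons_val, Fin.mk_zero, Fin.mk_one, Fin.reduceFinMk]
  all_goals
    simp only [mul_assoc, mul_inv_rev, inv_inv, one_mul, mul_one, inv_one, mul_inv_cancel_left, inv_mul_cancel_left,
      mul_inv_cancel, inv_mul_cancel, c_yi_bi', c_yi_ai', c_yi_a', c_yi_b', c_xi_bi', c_xi_ai', c_xi_a', c_xi_b', c_x_bi', c_x_ai', c_x_a', c_x_b', c_y_bi', c_y_ai', c_y_a', c_y_b', c_yi_bi, c_yi_ai, c_yi_a, c_yi_b, c_xi_bi, c_xi_ai, c_xi_a, c_xi_b, c_x_bi, c_x_ai, c_x_a, c_x_b, c_y_bi, c_y_ai, c_y_a, c_y_b]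

/-- Image of `a` in the separating finite quotient `Equiv.Perm (Fin 2)` (certificate data). [folklore] -/
def pa : Equiv.Perm (Fin 2) := ⟨![0, 1], ![0, 1], by decide, by decide⟩

/-- Image of `b` in the separating finite quotient `Equiv.Perm (Fin 2)` (certificate data). [folklore] -/
def pb : Equiv.Perm (Fin 2) := ⟨![0, 1], ![0, 1], by decide, by decide⟩

/-- Image of `x` in the separating finite quotient `Equiv.Perm (Fin 2)` (certificate data). [folklore] -/
def px : Equiv.Perm (Fin 2) := ⟨![1, 0], ![1, 0], by decide, by decide⟩

/-- Image of `y` in the separating finite quotient `Equiv.Perm (Fin 2)` (certificate data). [folklore] -/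
def py : Equiv.Perm (Fin 2) := ⟨![1, 0], ![1, 0], by decide, by decide⟩

/-- Letter images (certificate data). [folklore] -/
def pl : L → Equiv.Perm (Fin 2)
  | .a => pa | .b => pb | .x => px | .y => py

/-- The letter images satisfy the four relators. [cite: Caprace2017, Example 4.3] -/
theorem lift_r (k : Fin 4) : FreeGroup.lift pl (r k) = 1 := by
  fin_cases k <;> simp [r, pl] <;> decide

/-- The separating homomorphism to `Equiv.Perm (Fin 2)` (von Dyck). [folklore] -/
def φ : GammaSVGroup →* Equiv.Perm (Fin 2) :=
  PresentedGroup.toGroup (f := pl) (by rintro _ ⟨k, rfl⟩; exact lift_r k)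

/-- Value of `φ` on the generator `a`. [folklore] -/
@[simp] theorem φ_a : φ a = pa := PresentedGroup.toGroup.of _
/-- Value of `φ` on the generator `b`. [folklore] -/
@[simp] theorem φ_b : φ b = pb := PresentedGroup.toGroup.of _
/-- Value of `φ` on the generator `x`. [folklore] -/
@[simp] theorem φ_x : φ x = px := PresentedGroup.toGroup.of _
/-- Value of `φ` on the generator `y`. [folklore] -/
@[simp] theorem φ_y : φ y = py := PresentedGroup.toGroup.of _

/-- The images `φ (f i)` (certificate data). [folklore] -/
def fimg : Fin 49 → Equiv.Perm (Fin 2) :=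
  ![⟨![0, 1], ![0, 1], by decide, by decide⟩,
    ⟨![1, 0], ![1, 0], by decide, by decide⟩,
    ⟨![1, 0], ![1, 0], by decide, by decide⟩,
    ⟨![1, 0], ![1, 0], by decide, by decide⟩,
    ⟨![1, 0], ![1, 0], by decide, by decide⟩,
    ⟨![0, 1], ![0, 1], by decide, by decide⟩,
    ⟨![0, 1], ![0, 1], by decide, by decide⟩,
    ⟨![0, 1], ![0, 1], by decide, by decide⟩,
    ⟨![0, 1], ![0, 1], by decide, by decide⟩,
    ⟨![0, 1], ![0, 1], by decide, by decide⟩,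
    ⟨![0, 1], ![0, 1], by decide, by decide⟩,
    ⟨![0, 1], ![0, 1], by decide, by decide⟩,
    ⟨![0, 1], ![0, 1], by decide, by decide⟩,
    ⟨![0, 1], ![0, 1], by decide, by decide⟩,
    ⟨![0, 1], ![0, 1], by decide, by decide⟩,
    ⟨![0, 1], ![0, 1], by decide, by decide⟩,
    ⟨![0, 1], ![0, 1], by decide, by decide⟩,
    ⟨![0, 1], ![0, 1], by decide, by decide⟩,
    ⟨![0, 1], ![0, 1], by decide, by decide⟩,
    ⟨![0, 1], ![0, 1], by decide, by decide⟩,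
    ⟨![0, 1], ![0, 1], by decide, by decide⟩,
    ⟨![1, 0], ![1, 0], by decide, by decide⟩,
    ⟨![1, 0], ![1, 0], by decide, by decide⟩,
    ⟨![1, 0], ![1, 0], by decide, by decide⟩,
    ⟨![1, 0], ![1, 0], by decide, by decide⟩,
    ⟨![0, 1], ![0, 1], by decide, by decide⟩,
    ⟨![0, 1], ![0, 1], by decide, by decide⟩,
    ⟨![0, 1], ![0, 1], by decide, by decide⟩,
    ⟨![1, 0], ![1, 0], by decide, by decide⟩,
    ⟨![1, 0], ![1, 0], by decide, by decide⟩,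
    ⟨![1, 0], ![1, 0], by decide, by decide⟩,
    ⟨![1, 0], ![1, 0], by decide, by decide⟩,
    ⟨![0, 1], ![0, 1], by decide, by decide⟩,
    ⟨![0, 1], ![0, 1], by decide, by decide⟩,
    ⟨![0, 1], ![0, 1], by decide, by decide⟩,
    ⟨![1, 0], ![1, 0], by decide, by decide⟩,
    ⟨![1, 0], ![1, 0], by decide, by decide⟩,
    ⟨![1, 0], ![1, 0], by decide, by decide⟩,
    ⟨![1, 0], ![1, 0], by decide, by decide⟩,
    ⟨![0, 1], ![0, 1], by decide, by decide⟩,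
    ⟨![0, 1], ![0, 1], by decide, by decide⟩,
    ⟨![0, 1], ![0, 1], by decide, by decide⟩,
    ⟨![1, 0], ![1, 0], by decide, by decide⟩,
    ⟨![1, 0], ![1, 0], by decide, by decide⟩,
    ⟨![1, 0], ![1, 0], by decide, by decide⟩,
    ⟨![1, 0], ![1, 0], by decide, by decide⟩,
    ⟨![0, 1], ![0, 1], by decide, by decide⟩,
    ⟨![0, 1], ![0, 1], by decide, by decide⟩,
    ⟨![0, 1], ![0, 1], by decide, by decide⟩]

/-- `φ ∘ f = fimg`. [folklore] -/
theorem φ_f : ∀ i : Fin 49, φ (f i) = fimg i := by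
  intro i
  fin_cases i
  all_goals
    simp only [f, fimg, Fin.isValue, Matrix.cons_val_zero, Matrix.cons_val,
      Fin.mk_zero, Fin.mk_one, Fin.reduceFinMk, map_mul, map_inv, map_one, φ_a, φ_b, φ_x, φ_y]
  all_goals decide

/-- The finite quotient separates `f (J i)` from `f i` for every `i`. [folklore] -/
theorem fimg_ne : ∀ i : Fin 49, fimg (J i) ≠ fimg i := by decide

/-- The inequalities `f (J i) ≠ f i`, through the finite quotient. [cite: KionkeRaimbault2016, §2.1] -/
theorem f_ne (i : Fin 49) : f (J i) ≠ f i := by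
  intro h
  have h' := congrArg φ h
  rw [φ_f, φ_f] at h'
  exact fimg_ne i h'

/-- **`Γ_SV` is not diffuse**: the 49 words `f` form a ravel (a finite set without extremal
point) inside the ball of radius 2. Here the ravel is the entire ball of radius 2 (49 elements). [cite: Bowditch2000, §1] [cite: KionkeRaimbault2016, §2.1] -/
theorem not_diffuse : ¬ Diffuse GammaSVGroup :=
  not_diffuse_of_witnesses f J K f_ne f_rel

/-- Hence `Γ_SV` admits no left-invariant linear order (left-orderable groups are diffuse).
[cite: Bowditch2000, §1] -/
theorem not_leftOrdered [LinearOrder GammaSVGroup] : ¬ MulLeftStrictMono GammaSVGroup :=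
  fun _ => not_diffuse diffuse_of_mulLeftStrictMono

end GammaSV

end Literature.GroupTheory.BMWGroups.Caprace2017
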